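import Literature.NumberTheory.QuadraticFields.PrincipalCycleModules
import Literature.NumberTheory.QuadraticFields.RealQuadraticFundamentalUnit
import Mathlib.Algebra.Order.Archimedean.Basic
import HarnessLib

/-!
# Reduced principal modules lie on the principal cycle, II: the identification theorem

Topic `NumberTheory/QuadraticFields`; continues `PrincipalCycleModules.lean` (the `β`-basis of
`O`, the pinching lemma `eq_inv_valProd_of_isMinimum`). Theorem-only file (no definitions, no
named facts):

* `eq_of_val_eq`, `eq_of_jmod_eq` — a reduced quotient is determined by its module `ℤ + φℤ`;
* `mem_jmod_iterate_periodLength_iff : J(x_p) = O`; `IsQD.pow/zpow`;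
* **`exists_iterate_eq_of_jmod_eq_smul`** (Jozsa 2003, Thm. 4(c); Jacobson–Williams Thm. 5.18
  with (5.33)): a reduced `w` with `J(w) = κ·O`, `κ > 0` in `ℚ(√D)`, equals `x_n` for some
  `1 ≤ n ≤ p`, and `κ = Π_n · εʲ` (`j ∈ ℤ`) — so a reduced result of a giant step sits on the
  principal cycle at unrolled distance `log κ ≡ pos n (mod R)`.

## References

* R. Jozsa, arXiv:quant-ph/0302134 (2003), §6.3 Thm. 4(c), Prop. 29. [Jozsa2003]
* M. J. Jacobson, Jr., H. C. Williams, *Solving the Pell Equation*, Springer (2009), §5.3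
  Thm. 5.18, (5.33). [JacobsonWilliams2008]
-/

noncomputable section

open scoped Classical

namespace Literature.NumberTheory.QuadraticFields

namespace QuadIrr

variable {D : ℕ}

/-! ### Identification with the principal cycle -/

/-- `(P, Q)` is determined by `φ = (P + √D)/Q`. [cite: Jozsa2003, §1 (eq. (2))] -/
theorem eq_of_val_eq (hD : ¬ IsSquare D) {x y : QuadIrr D} (hx : x.Q ≠ 0) (hy : y.Q ≠ 0) (h : x.val = y.val) : x = y := by
  have ex : x.val = qd D (x.P / x.Q) (1 / x.Q) := by unfold qd val; push_cast; ring
  have ey : y.val = qd D (y.P / y.Q) (1 / y.Q) := by unfold qd val; push_cast; ring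
  rw [ex, ey] at h
  obtain ⟨h1, h2⟩ := qd_inj hD h
  have hQ : x.Q = y.Q := by
    have hx' : (x.Q : ℚ) ≠ 0 := by exact_mod_cast hx
    have hy' : (y.Q : ℚ) ≠ 0 := by exact_mod_cast hy
    have : (x.Q : ℚ) = y.Q := by field_simp at h2; exact_mod_cast h2.symm
    exact_mod_cast this
  have hP : x.P = y.P := by
    rw [hQ] at h1
    have hy' : (y.Q : ℚ) ≠ 0 := by exact_mod_cast hy
    have : (x.P : ℚ) = y.P := by field_simp at h1; exact_mod_cast h1
    exact_mod_cast this
  exact QuadIrr.ext hP hQ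

/-- **Reduced quotients with the same module are equal** (`ℤ + φℤ = ℤ + φ'ℤ` with
`φ, φ' > 1`, `φ̄, φ̄' ∈ (−1, 0)` forces `φ = φ'`). [cite: Jozsa2003, §6.1 Prop. 18 (uniqueness of the standard form)] -/
theorem eq_of_jmod_eq (hD : ¬ IsSquare D) {w w' : QuadIrr D} (hw : w.IsReduced) (hw' : w'.IsReduced)
    (h : ∀ t, t ∈ jmod w ↔ t ∈ jmod w') : w = w' := by
  obtain ⟨m, n, hmn⟩ := mem_jmod_iff.mp ((h w'.val).mpr (by have := intCast_add_mul_val_mem_jmod w' 0 1; simpa using this))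
  obtain ⟨m', n', hmn'⟩ := mem_jmod_iff.mp ((h w.val).mp (by have := intCast_add_mul_val_mem_jmod w 0 1; simpa using this))
  have hirr := irrational_val hD hw'.isAdmissible.1
  -- `n n' = 1`
  have hnn : n * n' = 1 := by
    by_contra hne
    have key : (1 - n * n' : ℝ) * w'.val = m + n * m' := by rw [hmn'] at hmn; linear_combination hmn
    have hne' : (1 - n * n' : ℝ) ≠ 0 := by
      have : (1 - n * n' : ℤ) ≠ 0 := by omega
      exact_mod_cast this
    apply hirr.ne_rat ((m + n * m') / (1 - n * n'))
    push_cast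
    rw [eq_div_iff hne']
    linarith
  have hconj : w'.conj = m + n * w.conj := by
    have := congrArg (conjOf D) hmn
    rwa [conjOf_val hD, conjOf_intCast_add_mul_val hD] at this
  have hφ : 1 < w.val := hw.2.2.1
  have hφ' : 1 < w'.val := hw'.2.2.1
  obtain ⟨hc1, hc2⟩ := hw.2.2.2
  obtain ⟨hc1', hc2'⟩ := hw'.2.2.2
  rcases Int.eq_one_or_neg_one_of_mul_eq_one hnn with hn | hn
  · subst hn
    have hm : m = 0 := by
      have h1 : (m : ℝ) < 1 := by push_cast at hconj; linarith
      have h2 : (-1 : ℝ) < m := by push_cast at hconj; linarith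
      have h1' : m < 1 := by exact_mod_cast h1
      have h2' : -1 < m := by exact_mod_cast h2
      omega
    subst hm
    simp at hmn
    exact (eq_of_val_eq hD hw.1.ne' hw'.1.ne' hmn.symm)
  · subst hn
    exfalso
    push_cast at hmn hconj
    have hm : m = -1 := by
      have h1 : (m : ℝ) < 0 := by linarith
      have h2 : (-2 : ℝ) < m := by linarith
      have h1' : m < 0 := by exact_mod_cast h1
      have h2' : -2 < m := by exact_mod_cast h2
      omega
    subst hm
    push_cast at hmn
    linarith

/-- `J(x_p) = J(x₀)` for the principal start: `x_p = (P_p, 2)` differs from `δ = (q, 2)` by an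
integer shift of `P`. [cite: JacobsonWilliams2008, §3.3 (Q_p = Q_0 = s, P_{p+1} = P_1)] -/
theorem mem_jmod_iterate_periodLength_iff (hD : ¬ IsSquare D) (hD4 : D % 4 = 0 ∨ D % 4 = 1) (t : ℝ) :
    t ∈ jmod (step^[periodLength D] (principalStart D)) ↔ t ∈ jmod (principalStart D) := by
  set xp := step^[periodLength D] (principalStart D) with hxp
  have hQ : xp.Q = 2 := Q_iterate_periodLength hD hD4
  have hadm : xp.IsAdmissible := isAdmissible_iterate hD (isPreReduced_principalStart hD hD4).isAdmissible _
  have hadm0 := (isPreReduced_principalStart hD hD4).isAdmissible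
  -- both `P`'s are `≡ D (mod 2)`
  have h2 : (2 : ℤ) ∣ xp.P - (principalStart D).P := by
    have hdx := hadm.2
    have hd0 := hadm0.2
    rw [hQ] at hdx
    rw [show (principalStart D).Q = 2 from rfl] at hd0
    have e : xp.P - (principalStart D).P =
        -((D : ℤ) - xp.P ^ 2) + ((D : ℤ) - (principalStart D).P ^ 2) - (xp.P ^ 2 - xp.P)
          + ((principalStart D).P ^ 2 - (principalStart D).P) := by ring
    rw [e]
    exact dvd_add (dvd_sub (dvd_add (dvd_neg.mpr hdx) hd0) (two_dvd_sq_sub_self _)) (two_dvd_sq_sub_self _)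
  obtain ⟨k, hk⟩ := h2
  have hshift : xp = shiftP (principalStart D) k := by
    refine QuadIrr.ext ?_ ?_
    · show xp.P = (principalStart D).P + k * (principalStart D).Q
      rw [show (principalStart D).Q = 2 from rfl]; linarith
    · show xp.Q = (principalStart D).Q
      rw [hQ]; rfl
  rw [hshift]
  exact mem_jmod_shiftP_iff (by show (principalStart D).Q ≠ 0; simp [principalStart]) k t

/-- Natural powers of elements of `ℚ(√D)` are in `ℚ(√D)`. [folklore] -/
theorem IsQD.pow {t : ℝ} (ht : IsQD D t) : ∀ k : ℕ, IsQD D (t ^ k)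
  | 0 => by simpa using IsQD.intCast (D := D) 1
  | k + 1 => by rw [pow_succ]; exact (ht.pow k).mul ht

/-- Integer powers of elements of `ℚ(√D)` are in `ℚ(√D)`. [folklore] -/
theorem IsQD.zpow (hD : ¬ IsSquare D) {t : ℝ} (ht : IsQD D t) (m : ℤ) : IsQD D (t ^ m) := by
  rcases Int.eq_nat_or_neg m with ⟨k, rfl | rfl⟩
  · rw [zpow_natCast]; exact ht.pow k
  · rw [zpow_neg, zpow_natCast]; exact (ht.pow k).inv hD

/-- **A reduced quotient with principal module lies on the principal cycle** (Jozsa Thm. 4(c);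
JW Thm. 5.18 with (5.33)): if `w` is reduced and `J(w) = κ·O`, `κ > 0` in `ℚ(√D)`, `O = J(δ)` the
order of discriminant `D ≡ 0, 1 (mod 4)`, then `w = x_n` for some `1 ≤ n ≤ p` and `κ = Π_n εʲ`
with `Π_n = ∏_{k=1}^{n} φ_k`, `ε` the fundamental unit, `j ∈ ℤ`.
[cite: Jozsa2003, §6.3 Thm. 4(c)] -/
theorem exists_iterate_eq_of_jmod_eq_smul (hD : ¬ IsSquare D) (hD4 : D % 4 = 0 ∨ D % 4 = 1)
    {w : QuadIrr D} (hw : w.IsReduced) {κ : ℝ} (hκ : 0 < κ) (hκQ : IsQD D κ)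
    (hJ : ∀ t, t ∈ jmod w ↔ ∃ s ∈ jmod (principalStart D), t = κ * s) :
    ∃ n : ℕ, 1 ≤ n ∧ n ≤ periodLength D ∧ w = step^[n] (principalStart D) ∧
      ∃ j : ℤ, κ = valProd (principalStart D) n * fundUnit D ^ j := by
  set x₀ := principalStart D with hx₀
  have h0 : x₀.IsPreReduced := isPreReduced_principalStart hD hD4
  set ε := fundUnit D with hεdef
  have hε1 : 1 < ε := one_lt_fundUnit hD hD4
  have hε0 : 0 < ε := by linarith
  set p := periodLength D with hp
  have hp1 : 1 ≤ p := periodLength_pos hD hD4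
  have hPip : valProd x₀ p = ε := (fundUnit_eq_valProd hD hD4).symm
  have hεQ : IsQD D ε := by rw [← hPip]; exact isQD_valProd x₀ p
  -- `O` is invariant under multiplication by `ε^{±1}`, hence by `ε^m`, `m ∈ ℤ`
  have hO : ∀ t, (∃ s ∈ jmod x₀, t = ε * s) ↔ t ∈ jmod x₀ := by
    intro t
    rw [← mem_jmod_iterate_periodLength_iff hD hD4 t, mem_jmod_iterate_iff hD h0 p t, hPip]
  have hεnat : ∀ k : ℕ, ∀ s ∈ jmod x₀, ε ^ k * s ∈ jmod x₀ ∧ (ε ^ k)⁻¹ * s ∈ jmod x₀ := by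
    intro k
    induction k with
    | zero => intro s hs; simpa using hs
    | succ k ih =>
      intro s hs
      obtain ⟨h1, h2⟩ := ih s hs
      constructor
      · rw [pow_succ, mul_comm (ε ^ k) ε, mul_assoc]
        exact (hO _).mp ⟨ε ^ k * s, h1, rfl⟩
      · obtain ⟨s', hs', hs's⟩ := (hO _).mpr h2
        have e : s = ε ^ k * (ε * s') := by
          have h : ε ^ k * ((ε ^ k)⁻¹ * s) = ε ^ k * (ε * s') := congrArg (fun t => ε ^ k * t) hs's
          rw [← mul_assoc, mul_inv_cancel₀ (pow_ne_zero _ hε0.ne'), one_mul] at h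
          exact h
        have : (ε ^ (k + 1))⁻¹ * s = s' := by
          rw [e, pow_succ]; field_simp
        rw [this]; exact hs'
  have hεz : ∀ m : ℤ, ∀ s ∈ jmod x₀, ε ^ m * s ∈ jmod x₀ := by
    intro m s hs
    rcases Int.eq_nat_or_neg m with ⟨k, rfl | rfl⟩
    · rw [zpow_natCast]; exact (hεnat k s hs).1
    · rw [zpow_neg, zpow_natCast]; exact (hεnat k s hs).2
  -- `λ = κ⁻¹` is a minimum of `O`
  set lam := κ⁻¹ with hlam
  have hlam0 : 0 < lam := inv_pos.mpr hκ
  have hset : {u | ∃ μ ∈ (jmod w : Set ℝ), u = lam * μ} = (jmod x₀ : Set ℝ) := by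
    ext u
    simp only [Set.mem_setOf_eq, SetLike.mem_coe]
    constructor
    · rintro ⟨μ, hμ, rfl⟩
      obtain ⟨s, hs, rfl⟩ := (hJ μ).mp hμ
      have : lam * (κ * s) = s := by rw [hlam]; field_simp
      rw [this]; exact hs
    · intro hu
      exact ⟨κ * u, (hJ _).mpr ⟨u, hu, rfl⟩, by rw [hlam]; field_simp⟩
  have hminl : IsMinimum D (jmod x₀ : Set ℝ) lam := by
    have := isMinimum_smul hD hlam0 (hκQ.inv hD) (fun μ hμ => isQD_of_mem_jmod hμ) (isMinimum_one_of_isReduced hD hw)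
    rwa [hset, mul_one] at this
  -- unit adjustment: `λ' = λ ε^{-(m+1)} ∈ (ε⁻¹, 1]`
  obtain ⟨m, hm1, hm2⟩ := exists_mem_Ioc_zpow hlam0 hε1
  set c := (ε ^ (m + 1))⁻¹ with hc
  have hc0 : 0 < c := inv_pos.mpr (zpow_pos hε0 _)
  have hcQ : IsQD D c := (hεQ.zpow hD (m + 1)).inv hD
  set lam' := c * lam with hlam'
  have hlam'1 : lam' ≤ 1 := by
    rw [hlam', hc, inv_mul_le_iff₀ (zpow_pos hε0 _), mul_one]; exact hm2
  have hlam'2 : ε⁻¹ < lam' := by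
    rw [hlam', hc]
    have : ε ^ m = ε ^ (m + 1) * ε⁻¹ := by rw [zpow_add_one₀ hε0.ne']; field_simp
    rw [this] at hm1
    rw [lt_inv_mul_iff₀ (zpow_pos hε0 _)]
    linarith
  have hset' : {u | ∃ μ ∈ (jmod x₀ : Set ℝ), u = c * μ} = (jmod x₀ : Set ℝ) := by
    ext u
    simp only [Set.mem_setOf_eq, SetLike.mem_coe]
    constructor
    · rintro ⟨μ, hμ, rfl⟩
      rw [hc, ← zpow_neg]; exact hεz _ μ hμ
    · intro hu
      refine ⟨ε ^ (m + 1) * u, hεz _ u hu, ?_⟩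
      rw [hc]; field_simp
  have hminl2 : IsMinimum D (jmod x₀ : Set ℝ) lam' := by
    have := isMinimum_smul hD hc0 hcQ (fun μ hμ => isQD_of_mem_jmod hμ) hminl
    rwa [hset'] at this
  -- pinching: `λ' = β_N`
  obtain ⟨N, hN⟩ := eq_inv_valProd_of_isMinimum hD h0 hminl2 hlam'1
  -- `N < p` since `β_N = λ' > ε⁻¹ = β_p` and `β` is decreasing
  have hNp : N < p := by
    by_contra hge
    push Not at hge
    have hmono : valProd x₀ p ≤ valProd x₀ N := by
      obtain ⟨d, rfl⟩ := Nat.exists_eq_add_of_le hge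
      clear hN hge
      induction d with
      | zero => simp
      | succ d ih =>
        rw [← Nat.add_assoc, valProd_succ]
        have := (h0.isReduced_iterate_succ hD (p + d)).2.2.1
        have := valProd_pos hD h0 (p + d)
        nlinarith
    have : (valProd x₀ N)⁻¹ ≤ (valProd x₀ p)⁻¹ := inv_anti₀ (valProd_pos hD h0 p) hmono
    rw [hPip, ← hN] at this
    linarith
  -- `κ = Π_N ε^{-(m+1)}`
  have hκ_eq : κ = valProd x₀ N * ε ^ (-(m + 1)) := by
    have : lam' = c * κ⁻¹ := rfl
    rw [hN, hc] at this
    have hPi0 := (valProd_pos hD h0 N).ne'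
    have hz0 : ε ^ (m + 1) ≠ 0 := (zpow_pos hε0 _).ne'
    rw [zpow_neg]
    field_simp at this ⊢
    linarith
  -- `J(w) = J(x_N)`
  have hJN : ∀ t, t ∈ jmod w ↔ t ∈ jmod (step^[N] x₀) := by
    intro t
    rw [hJ, mem_jmod_iterate_iff hD h0 N]
    constructor
    · rintro ⟨s, hs, rfl⟩
      refine ⟨ε ^ (-(m + 1)) * s, hεz _ s hs, ?_⟩
      rw [hκ_eq]; ring
    · rintro ⟨s, hs, rfl⟩
      refine ⟨ε ^ (m + 1) * s, hεz _ s hs, ?_⟩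
      rw [hκ_eq, mul_assoc, ← mul_assoc (ε ^ (-(m + 1))), ← zpow_add₀ hε0.ne']
      simp
  rcases Nat.eq_zero_or_pos N with hN0 | hN0
  · -- `N = 0`: `J(w) = O = J(x_p)`, so `w = x_p`
    refine ⟨p, hp1, le_rfl, ?_, -(m + 1) - 1, ?_⟩
    · apply eq_of_jmod_eq hD hw
      · rw [hp]
        obtain ⟨d, hd⟩ : ∃ d, periodLength D = d + 1 := ⟨periodLength D - 1, by omega⟩
        rw [hd]; exact h0.isReduced_iterate_succ hD d
      · intro t
        rw [hJN t, hN0, Function.iterate_zero, id_eq, mem_jmod_iterate_periodLength_iff hD hD4]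
    · rw [hκ_eq, hN0, hPip, zpow_sub₀ hε0.ne', zpow_one]
      simp [valProd]
      field_simp
  · refine ⟨N, hN0, hNp.le, ?_, -(m + 1), hκ_eq⟩
    apply eq_of_jmod_eq hD hw
    · obtain ⟨d, hd⟩ : ∃ d, N = d + 1 := ⟨N - 1, by omega⟩
      rw [hd]; exact h0.isReduced_iterate_succ hD d
    · exact hJN

end QuadIrr

end Literature.NumberTheory.QuadraticFields

end
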